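import Mathlib
import Literature.MathematicalPhysics.QuantumFieldTheory.GaugeOSData
import Literature.MathematicalPhysics.QuantumLattice.WilsonBlockHeatBathLightCone2
import Summits.QuantumFields.YangMills.Theorems.ClusteringToYangMills.Negative.AdapterCover
import HarnessLib

/-!
# `ContinuumLegGivenGap` (stmt-QuantumFields-8782), line `Sketch`, reshape 5 — stub `stub_dominationCompose`

Support file for stmt-QuantumFields-8782 (crux
`Summit.QuantumFields.YangMills.Theses.ConvexGribovBody.ContinuumLegGivenGap`), line `Sketch`,
reshape 5, stub `stub_dominationCompose`: SEPARABLE DOMINATION of the per-β clustering constants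
⇒ the ADAPTER, by rate sacrifice.

The hypothesis (`SeparableDomination` of the line, unfolded): at every compact simple `(G, r)` with
per-β volume-uniform torus clustering above `β₀` there are `β₁` and a β-INDEPENDENT template
`b : YMSpecies G → YMSpecies G → ℝ` such that at each `β ≥ β₁`, for some rate `μ(β) > 0` and some
multiplier `ν(β)`, every pair `(A, B)` obeys
`|corr_{β,2S+1}(A, B; n)| ≤ ‖A‖∞ ‖B‖∞ · exp(ν(β) · b(A, B)) · e^{−μ(β) n}` on all tori, `n ≤ S`.

The conclusion (`Adapter` of the line, unfolded = hypothesis (1) of the hub stmt-QuantumFields-8762):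
β-FREE per-pair constants with a rate FUNCTION `m(β) > 0` and a threshold function `S₀(β)`.

Proof (trade rate for constant). For a pair `(A, B)` with sup norms `a = ‖A‖∞`, `a' = ‖B‖∞`, the
a priori bound `|corr| ≤ 2 a a'` (the torus Wilson state is a probability measure) and the dominated
bound `a a' · e^{|ν(β)| |b(A,B)|} · e^{−μ(β) n}` combine by `rate_sacrifice` into the β-free constant
`max 1 (2 a a') · max 1 (a a') · e^{|b(A,B)|}` at the sacrificed rate `μ(β) / max 1 |ν(β)|`
(`S₀ ≡ 0`). [folklore]
-/

noncomputable section

namespace Summit.QuantumFields.YangMills.Theorems.ContinuumLegGivenGap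

open Literature.MathematicalPhysics.QuantumFieldTheory
open Literature.MathematicalPhysics.QuantumLattice.WilsonBlockHeatBath
  (abs_latticeConnectedCorr_le_two_mul)
open Summit.QuantumFields.YangMills.Theorems.ClusteringToYangMills.Negative (rate_sacrifice)

/-- The sup norm `⨆ V, |A.F V|` of a local gauge-invariant observable bounds it pointwise (the range
of `|A.F|` is bounded above by `A.bounded`). [folklore] -/
theorem abs_apply_le_iSup {G : Type} [Group G] [MeasurableSpace G] (A : YMSpecies G)
    (U : Literature.MathematicalPhysics.QuantumLattice.LGConfig 4 G) :
    |A.F U| ≤ ⨆ V, |A.F V| := by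
  have hbdd : BddAbove (Set.range fun V => |A.F V|) := by
    obtain ⟨C, hC⟩ := A.bounded
    exact ⟨C, by rintro _ ⟨V, rfl⟩; exact hC V⟩
  exact le_ciSup hbdd U

/-- **The adapter from separable domination of the clustering constants**
(`SeparableDomination → Adapter` of line `Sketch`, reshape 5, unfolded): if above `β₁` a
β-independent template `b(A, B)` dominates the per-β clustering constants in the form
`‖A‖∞ ‖B‖∞ exp(ν(β) b(A, B))` at rate `μ(β) > 0`, then per-β torus clustering upgrades to β-FREE
per-pair constants `max 1 (2‖A‖∞‖B‖∞) · max 1 (‖A‖∞‖B‖∞) · e^{|b(A,B)|}` with the rate function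
`μ(β) / max 1 |ν(β)|` and thresholds `S₀ ≡ 0` — the a priori bound `|corr| ≤ 2‖A‖∞‖B‖∞` and the
dominated bound combined by `rate_sacrifice`. [folklore] -/
theorem stub_dominationCompose :
    (∀ (G : Type) [Group G] [TopologicalSpace G] [IsTopologicalGroup G] [CompactSpace G]
      [MeasurableSpace G] [BorelSpace G], IsCompactSimpleLieGroup G → ∀ r : LatticeRep G,
      (∃ β₀ : ℝ, ∀ β : ℝ, β₀ ≤ β → ∃ m : ℝ, 0 < m ∧ TorusClusteringAt r β m) →
        ∃ (β₁ : ℝ) (b : YMSpecies G → YMSpecies G → ℝ), ∀ β : ℝ, β₁ ≤ β → ∃ μ : ℝ, 0 < μ ∧ ∃ ν : ℝ,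
          ∀ A B : YMSpecies G, ∀ S n : ℕ, n ≤ S →
            |latticeConnectedCorr r.ρ β (2 * S + 1) A.F B.F n| ≤
              (⨆ U, |A.F U|) * (⨆ U, |B.F U|) * Real.exp (ν * b A B) * Real.exp (-(μ * n))) →
    ∀ (G : Type) [Group G] [TopologicalSpace G] [IsTopologicalGroup G] [CompactSpace G]
      [MeasurableSpace G] [BorelSpace G], IsCompactSimpleLieGroup G → ∀ r : LatticeRep G,
      (∃ β₀ : ℝ, ∀ β : ℝ, β₀ ≤ β → ∃ m : ℝ, 0 < m ∧ TorusClusteringAt r β m) →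
        ∃ (β₁ : ℝ) (m : ℝ → ℝ) (S₀ : ℝ → ℕ), (∀ β : ℝ, β₁ ≤ β → 0 < m β) ∧
          ∀ A B : YMSpecies G, ∃ C : ℝ, ∀ β : ℝ, β₁ ≤ β → ∀ S n : ℕ, S₀ β ≤ S → n ≤ S →
            |latticeConnectedCorr r.ρ β (2 * S + 1) A.F B.F n| ≤ C * Real.exp (-(m β * n)) := by
  intro hSD G _ _ _ _ _ _ hG r hH
  obtain ⟨β₁, b, hβ⟩ := hSD G hG r hH
  choose μ hμ ν hν using hβ
  refine ⟨β₁, fun β => if h : β₁ ≤ β then μ β h / max 1 |ν β h| else 1, fun _ => 0, ?_, ?_⟩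
  · -- positivity of the sacrificed rate
    intro β hβ
    simp only [hβ, ↓reduceDIte]
    exact div_pos (hμ β hβ) (lt_of_lt_of_le one_pos (le_max_left _ _))
  · intro A B
    -- the sup norms `a = ‖A‖∞`, `a' = ‖B‖∞`
    have ha : ∀ U, |A.F U| ≤ ⨆ V, |A.F V| := abs_apply_le_iSup A
    have ha' : ∀ U, |B.F U| ≤ ⨆ V, |B.F V| := abs_apply_le_iSup B
    refine ⟨max 1 (2 * ((⨆ V, |A.F V|) * ⨆ V, |B.F V|)) * max 1 ((⨆ V, |A.F V|) * ⨆ V, |B.F V|) *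
      Real.exp |b A B|, fun β hβ S n _ hn => ?_⟩
    -- the a priori bound
    have h1 : |latticeConnectedCorr r.ρ β (2 * S + 1) A.F B.F n| ≤
        max 1 (2 * ((⨆ V, |A.F V|) * ⨆ V, |B.F V|)) :=
      (abs_latticeConnectedCorr_le_two_mul r β (2 * S + 1) ha ha' n).trans (le_max_right _ _)
    -- the dominated bound, with `ν b ≤ |ν| |b|` and `a a' ≤ max 1 (a a')`
    have h2 : |latticeConnectedCorr r.ρ β (2 * S + 1) A.F B.F n| ≤
        max 1 ((⨆ V, |A.F V|) * ⨆ V, |B.F V|) * Real.exp (|ν β hβ| * |b A B|) *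
          Real.exp (-(μ β hβ * n)) := by
      calc |latticeConnectedCorr r.ρ β (2 * S + 1) A.F B.F n|
          ≤ (⨆ V, |A.F V|) * (⨆ V, |B.F V|) * Real.exp (ν β hβ * b A B) *
              Real.exp (-(μ β hβ * n)) := hν β hβ A B S n hn
        _ ≤ max 1 ((⨆ V, |A.F V|) * ⨆ V, |B.F V|) * Real.exp (|ν β hβ| * |b A B|) *
              Real.exp (-(μ β hβ * n)) := by
          refine mul_le_mul_of_nonneg_right ?_ (Real.exp_pos _).le
          refine mul_le_mul (le_max_right _ _) (Real.exp_le_exp.2 ?_) (Real.exp_pos _).le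
            (le_trans zero_le_one (le_max_left _ _))
          rw [← abs_mul]
          exact le_abs_self _
    -- rate sacrifice
    have := rate_sacrifice (le_max_left _ _) (le_max_left _ _) (abs_nonneg (b A B)) h1 h2
    simpa only [hβ, ↓reduceDIte] using this

end Summit.QuantumFields.YangMills.Theorems.ContinuumLegGivenGap

end
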